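import Literature.MathematicalPhysics.QuantumFieldTheory.Balaban1983to89.B9Thm314WholeCancellationLayer
import Literature.MathematicalPhysics.QuantumFieldTheory.Balaban1983to89.B9Thm314Thm315RecordVacuity
import Literature.MathematicalPhysics.QuantumFieldTheory.Balaban1983to89.Node00.OpsYSectDE

/-!
# `Balaban1983to89.B9Thm314Thm315RecordDE` — ROWS 22–24 OF THE N06 CERTIFICATE AT def-Y v3's INSTANCE OF RECORD `Node00.opsYOfRecordDE`
# (GENUINE `Kdiff = KdiffY`: Theorem 3.14 through the cancellation reading PROVED; `Ck` still flat: Theorem 3.15 vacuous modulo its slots)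

T. Bałaban, *Propagators for lattice gauge theories in a background field*, Commun. Math. Phys. **99** (1985) 389–434
[`Balaban1985BackgroundPropagators`, "B9"].

statement-level skeleton of published theorems with citation tags; proofs where landed; nothing here is a claim about the Yang–Mills mass gap

THE PRINTED LOCI (verbatim).  Theorem 3.14, p. 427: *"If we take a pair of operators constructed for the two sequences {Ω_j}, {Ω′_j}, then their
difference satisfies all the inequalities characteristic for operators of the considered type, with the additional factor exp(−δ₀d(y, y′, Ω))
…"*; its proof, p. 427: *"We take random walk expansions for both operators. … in the difference they are cancelled …"*; Theorem 3.15, p. 432.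

THE POINT.  def-Y v3 (`Node00.OpsYSectDE`, p492998) fills the Sect. D∕E letters: at `lettersYOfRecordDE N θ M⋆ 𝔯` the Theorem-3.14 letter is
GENUINE, `Kdiff = KdiffY … x = (U ↦ GAv2Y … U − GAsndY … U)` — the difference of the propagators G(U) of the member's two domain sequences
(`lettersYOfRecordDE_Kdiff`) — while `Ck` (C^{(k)}(Λ), block sector) stays the flat `0` (`lettersYOfRecordDE_P349_Ck`, LOCATED).  Hence at
`ops := opsYOfRecordDE N θ M⋆ 𝔯 𝔈` rows 22–23 are NO LONGER vacuous (contrast `B9Thm314Thm315RecordVacuity` for v2's `opsYOfRecord`) and the route is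
the seat's cancellation chain; row 24 is as at v2.  THIS FILE states both at the v3 record, for the knit to consume BY NAME:
* §1 row 24: `opsYOfRecordDE_Ck` (`rfl`), ★ `t315_opsYOfRecordDE_of_slots` — `t315` from 𝔈's two slots only (vacuous bound; LOCATED).
* §2 rows 22 ∧ 23: `opsYOfRecordDE_Kdiff` (`rfl`), ★★ `thm314_pair_opsYOfRecordDE` — `t314 ∧ t314loc` at the v3 record from: the walk-term letters
  `T₁ T₂` of the two expansions with their Theorem-3.10 all-norms leaves read through `kernelFamilyB` (`h₁ h₂`), the walks' localisation data
  `X₁ M₁ X₂ M₂ diam` with the operator-layer laws (`near ∕ first ∕ chain`, geometry by `B9Thm314WholePinGeometry.locDataY_laws`), the M-uniform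
  diameter bound `hr` (flag T314 (ii) STANDS), per-sequence walk sets `W₁ W₂` (`WalkSetsSpec`, `WalkWeightsSummable`), and the located approximation
  identity `hexp : ExpansionReads … (KdiffY … x) (pairOp … (T₁ x) (T₂ x)) (pairWalkSets …) U` under «both expansions converge at U» — the cancellation
  of p. 427 in operator form for the GENUINE letter (supplier's checklist: the seat's `EXPANSIONREADS-SUPPLIER-NOTE.md`).

HONEST SCOPE.  Count-neutral: row 24 vacuous at the pin (flat `Ck`); rows 22–23 supplied MODULO displayed operator-level hypotheses of printed ∕
located shape about def-Y's genuine letter `KdiffY` (two Theorem-3.10 letters, localisation data, walk sets, `hr`, the expansion identity) — none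
proved here; nothing of print asserted; NOT a node discharge, NOT summit progress; one finite lattice paper; nothing continuum, nothing about the mass
gap.  Cell `pub-ymgap` (D-0062), node N06 [B9], N06-ASSIGNMENT v1 rows 22–24 (successor file of bundle F8), seat `pub-ymgap-dag-n06-m` (g3), 2026-08-27.
-/

noncomputable section

namespace Literature.MathematicalPhysics.QuantumFieldTheory.Balaban1983to89.B9Thm314Thm315RecordDE

open B9 B9Thm314 B9FromB6ModelSignsOn
open B6KLevelCensusIndexV1 (KIdx)
open B6Ineq2142KLevelV1 (β)
open B9GeoNormsKLevelModelSignsV1 (modelSignsOn_geo9K)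
open B9PinMembersKLevelV1 (MemberY geo9Y bg9Y)
open B9PinGeometryKLevelV1 (kLab dOmegaY OmKY dOmegaY_nonneg c35Y inΛY unitDistY)
open B9Thm314GpFlatTorusGeometry (tdistK OmegaC)
open B9Thm314WholePinGeometry (locDataY locDataY_laws)
open B9Thm314WholePair (pairExpansion pairTermK locData₂)
open B9Thm314WholePairWalks (pairWalkSets)
open B9Thm314WholeSummation (WalkSetsSpec WalkWeightsSummable)
open B9SectCWalkTermsAllNorms (Thm310AllNormsPrinted)
open B9Thm314WholeExpansionReads (ExpansionReads)
open B9Thm314WholeCancellationLayer (pairOp thm314_pair_layerOfLetters)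
open B9Thm314Thm315RecordVacuity (thm315FullPrinted_of_ker_zero)
open B9RecordDELettersVacuity (siteKernelOfOp_zero_ker)
open B7Prop2SpecialUnitary (specialUnitaryUnits)
open Node00 (BlkY BondOpY kernelFamilyB siteKernelOfOp Stage3Params ExpsY ResY KdiffY lettersYOfRecordDE opsYOfRecordDE)

open scoped Matrix.Norms.L2Operator

variable (N : ℕ) (θ : Stage3Params) (Mstar : ℕ) (𝔯 : ResY N θ Mstar) (𝔈 : ExpsY N θ Mstar)

/-! ## §1 Row 24 at the v3 record: the `Ck` letter is still flat -/

/-- the `Ck` kernel of the v3 record IS the reading of the zero letter (LOCATED: C^{(k)}(Λ) is not constructed at v3).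
[cite: Balaban1985BackgroundPropagators, Thm 3.15 (3.187) p.432, bookkeeping] -/
theorem opsYOfRecordDE_Ck (x : MemberY θ.d₆ θ.ℓ₆ θ.hd' θ.hL' θ.b₀ θ.b₁ Mstar) :
    ((opsYOfRecordDE N θ Mstar 𝔯 𝔈) x).Ck =
      siteKernelOfOp x.toKIdx (bg9Y (Matrix (Fin N) (Fin N) ℂ) (specialUnitaryUnits (Fin N)) x) (fun U => U)
        (fun _ => (0 : (BlkY x.toKIdx → Matrix (Fin N) (Fin N) ℂ) →ₗ[ℂ] (BlkY x.toKIdx → Matrix (Fin N) (Fin N) ℂ)))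
        (β x.hN x.D x.hk) (β x.hN x.D x.hk) := rfl

/-- ★ **ROW 24 (`t315`) AT THE v3 RECORD FROM THE TWO SLOTS OF `𝔈` ONLY** (the bound (3.187) is vacuous: flat `Ck`).
[cite: Balaban1985BackgroundPropagators, Thm 3.15 (3.185)–(3.187) p.432] -/
theorem t315_opsYOfRecordDE_of_slots {δ₀ : ℝ} (hδ₀ : 0 < δ₀)
    (hG : ∀ (x : MemberY θ.d₆ θ.ℓ₆ θ.hd' θ.hL' θ.b₀ θ.b₁ Mstar) (U : (bg9Y (Matrix (Fin N) (Fin N) ℂ) (specialUnitaryUnits (Fin N)) x).Cfg),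
      ((opsYOfRecordDE N θ Mstar 𝔯 𝔈) x).GivenBy3185 U)
    (hH : ∀ (x : MemberY θ.d₆ θ.ℓ₆ θ.hd' θ.hL' θ.b₀ θ.b₁ Mstar) (U : (bg9Y (Matrix (Fin N) (Fin N) ℂ) (specialUnitaryUnits (Fin N)) x).Cfg),
      ((opsYOfRecordDE N θ Mstar 𝔯 𝔈) x).HasRWExpC U δ₀) :
    B9.Thm315FullPrinted c35Y geo9Y (bg9Y (Matrix (Fin N) (Fin N) ℂ) (specialUnitaryUnits (Fin N)))
      (fun x => ((opsYOfRecordDE N θ Mstar 𝔯 𝔈) x).Ck) inΛY unitDistY (fun x => ((opsYOfRecordDE N θ Mstar 𝔯 𝔈) x).GivenBy3185)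
      (fun x => ((opsYOfRecordDE N θ Mstar 𝔯 𝔈) x).HasRWExpC) :=
  thm315FullPrinted_of_ker_zero _ _ _ _ _ (fun x U y y' => by rw [opsYOfRecordDE_Ck]; exact siteKernelOfOp_zero_ker _ _ _ _ _ U y y')
    hδ₀ hG hH

/-! ## §2 Rows 22 ∧ 23 at the v3 record: the genuine letter `KdiffY` through the cancellation reading -/

/-- the `Kdiff` family of the v3 record IS def-Y's bond-sector reading of the GENUINE letter `KdiffY` (G for {Ω_j} minus G for {Ω′_j}).
[cite: Balaban1985BackgroundPropagators, Thm 3.14 pp.426–427, bookkeeping] -/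
theorem opsYOfRecordDE_Kdiff (x : MemberY θ.d₆ θ.ℓ₆ θ.hd' θ.hL' θ.b₀ θ.b₁ Mstar) :
    ((opsYOfRecordDE N θ Mstar 𝔯 𝔈) x).Kdiff =
      kernelFamilyB x.toKIdx (bg9Y (Matrix (Fin N) (Fin N) ℂ) (specialUnitaryUnits (Fin N)) x) (fun U => U)
        (KdiffY (Matrix (Fin N) (Fin N) ℂ) x) (lettersYOfRecordDE N θ Mstar 𝔯 x).parB := rfl

/-- ★★ **ROWS 22 ∧ 23 (`t314`, `t314loc`) AT def-Y v3's INSTANCE OF RECORD, THE CANCELLATION READING PROVED**: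
`B9Thm314WholeCancellationLayer.thm314_pair_layerOfLetters` at `𝔏 := lettersYOfRecordDE N θ M⋆ 𝔯` with the geometry pinned by
`locDataY ∕ locDataY_laws` and the signs by `modelSignsOn_geo9K`.  Displayed (operator-level, about the genuine letter `KdiffY … x`): the two
sequences' walk-term letters `T₁ T₂` with their Theorem-3.10 all-norms leaves `h₁ h₂` (read through `kernelFamilyB`), the localisation data
`X₁ M₁ X₂ M₂ diam` with the laws `near ∕ first ∕ chain`, the M-uniform diameter bound `hr` (flag T314 (ii) STANDS), the per-sequence walk sets
`W₁ W₂` with `WalkSetsSpec ∕ WalkWeightsSummable`, and the located approximation identity `hexp` for `KdiffY` under «both expansions converge at U».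
NOT a node discharge. [cite: Balaban1985BackgroundPropagators, Thm 3.14 (3.154) pp.426–427] -/
theorem thm314_pair_opsYOfRecordDE
    {E₁ E₂ : ∀ x : MemberY θ.d₆ θ.ℓ₆ θ.hd' θ.hL' θ.b₀ θ.b₁ Mstar,
      B9.RWExpansion (geo9Y x) (bg9Y (Matrix (Fin N) (Fin N) ℂ) (specialUnitaryUnits (Fin N)) x)}
    (T₁ : ∀ x : MemberY θ.d₆ θ.ℓ₆ θ.hd' θ.hL' θ.b₀ θ.b₁ Mstar, (E₁ x).Walk → BondOpY (Matrix (Fin N) (Fin N) ℂ) x.toKIdx)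
    (T₂ : ∀ x : MemberY θ.d₆ θ.ℓ₆ θ.hd' θ.hL' θ.b₀ θ.b₁ Mstar, (E₂ x).Walk → BondOpY (Matrix (Fin N) (Fin N) ℂ) x.toKIdx)
    (X₁ : ∀ x : MemberY θ.d₆ θ.ℓ₆ θ.hd' θ.hL' θ.b₀ θ.b₁ Mstar, (E₁ x).Walk → ℕ → (geo9Y x).Site → Prop)
    (M₁ : ∀ x : MemberY θ.d₆ θ.ℓ₆ θ.hd' θ.hL' θ.b₀ θ.b₁ Mstar, (E₁ x).Walk → ℕ → Prop)
    (X₂ : ∀ x : MemberY θ.d₆ θ.ℓ₆ θ.hd' θ.hL' θ.b₀ θ.b₁ Mstar, (E₂ x).Walk → ℕ → (geo9Y x).Site → Prop)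
    (M₂ : ∀ x : MemberY θ.d₆ θ.ℓ₆ θ.hd' θ.hL' θ.b₀ θ.b₁ Mstar, (E₂ x).Walk → ℕ → Prop)
    (diam : MemberY θ.d₆ θ.ℓ₆ θ.hd' θ.hL' θ.b₀ θ.b₁ Mstar → ℝ) (r₀ : ℝ) (hr : ∀ x, diam x ≤ r₀)
    (near₁ : ∀ (x : MemberY θ.d₆ θ.ℓ₆ θ.hd' θ.hL' θ.b₀ θ.b₁ Mstar) ω m p, M₁ x ω m → X₁ x ω m p →
      ∃ q, q ∈ OmegaC x.D x.D' ∧ tdistK (ℓ := θ.ℓ₆) (Mh := x.Mh) (k := x.k) (P := x.P') (kLab x p) q ≤ diam x)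
    (first₁ : ∀ (x : MemberY θ.d₆ θ.ℓ₆ θ.hd' θ.hL' θ.b₀ θ.b₁ Mstar) ω y, (E₁ x).first ω y → X₁ x ω 0 y)
    (chain₁ : ∀ (x : MemberY θ.d₆ θ.ℓ₆ θ.hd' θ.hL' θ.b₀ θ.b₁ Mstar) ω y y', (E₁ x).first ω y → (E₁ x).last ω y' →
      ∃ l : List (geo9Y x).Site, l.length = (E₁ x).wlen ω ∧ (∀ (m : ℕ) (hm : m < l.length), X₁ x ω (m + 1) (l[m])) ∧
        B9Thm314.chainSum (geo9Y x).dist y l y' ≤ (E₁ x).wdist ω y y')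
    (near₂ : ∀ (x : MemberY θ.d₆ θ.ℓ₆ θ.hd' θ.hL' θ.b₀ θ.b₁ Mstar) ω m p, M₂ x ω m → X₂ x ω m p →
      ∃ q, q ∈ OmegaC x.D x.D' ∧ tdistK (ℓ := θ.ℓ₆) (Mh := x.Mh) (k := x.k) (P := x.P') (kLab x p) q ≤ diam x)
    (first₂ : ∀ (x : MemberY θ.d₆ θ.ℓ₆ θ.hd' θ.hL' θ.b₀ θ.b₁ Mstar) ω y, (E₂ x).first ω y → X₂ x ω 0 y)
    (chain₂ : ∀ (x : MemberY θ.d₆ θ.ℓ₆ θ.hd' θ.hL' θ.b₀ θ.b₁ Mstar) ω y y', (E₂ x).first ω y → (E₂ x).last ω y' →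
      ∃ l : List (geo9Y x).Site, l.length = (E₂ x).wlen ω ∧ (∀ (m : ℕ) (hm : m < l.length), X₂ x ω (m + 1) (l[m])) ∧
        B9Thm314.chainSum (geo9Y x).dist y l y' ≤ (E₂ x).wdist ω y y')
    (h₁ : Thm310AllNormsPrinted c35Y geo9Y (bg9Y (Matrix (Fin N) (Fin N) ℂ) (specialUnitaryUnits (Fin N))) E₁
      (fun x ω => kernelFamilyB x.toKIdx (bg9Y (Matrix (Fin N) (Fin N) ℂ) (specialUnitaryUnits (Fin N)) x) (fun U => U) (T₁ x ω)
        (lettersYOfRecordDE N θ Mstar 𝔯 x).parB))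
    (h₂ : Thm310AllNormsPrinted c35Y geo9Y (bg9Y (Matrix (Fin N) (Fin N) ℂ) (specialUnitaryUnits (Fin N))) E₂
      (fun x ω => kernelFamilyB x.toKIdx (bg9Y (Matrix (Fin N) (Fin N) ℂ) (specialUnitaryUnits (Fin N)) x) (fun U => U) (T₂ x ω)
        (lettersYOfRecordDE N θ Mstar 𝔯 x).parB))
    (W₁ : ∀ x : MemberY θ.d₆ θ.ℓ₆ θ.hd' θ.hL' θ.b₀ θ.b₁ Mstar, ℕ → (geo9Y x).Site → (geo9Y x).Site → Finset (E₁ x).Walk)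
    (W₂ : ∀ x : MemberY θ.d₆ θ.ℓ₆ θ.hd' θ.hL' θ.b₀ θ.b₁ Mstar, ℕ → (geo9Y x).Site → (geo9Y x).Site → Finset (E₂ x).Walk)
    (hW₁ : ∀ x, WalkSetsSpec (E₁ x) (W₁ x)) (hW₂ : ∀ x, WalkSetsSpec (E₂ x) (W₂ x))
    (hcnt₁ : WalkWeightsSummable geo9Y (bg9Y (Matrix (Fin N) (Fin N) ℂ) (specialUnitaryUnits (Fin N))) E₁ W₁)
    (hcnt₂ : WalkWeightsSummable geo9Y (bg9Y (Matrix (Fin N) (Fin N) ℂ) (specialUnitaryUnits (Fin N))) E₂ W₂)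
    (hexp : ∀ (x : MemberY θ.d₆ θ.ℓ₆ θ.hd' θ.hL' θ.b₀ θ.b₁ Mstar) (U : (bg9Y (Matrix (Fin N) (Fin N) ℂ) (specialUnitaryUnits (Fin N)) x).Cfg),
      (E₁ x).Converges U ∧ (E₂ x).Converges U →
      ExpansionReads x.toKIdx (B := bg9Y (Matrix (Fin N) (Fin N) ℂ) (specialUnitaryUnits (Fin N)) x) (fun U => U)
        (KdiffY (Matrix (Fin N) (Fin N) ℂ) x)
        (pairOp (locDataY x (E₁ x) (X₁ x) (M₁ x) (diam x)).Touches
          (locData₂ (locDataY x (E₁ x) (X₁ x) (M₁ x) (diam x)) (X₂ x) (M₂ x)).Touches (T₁ x) (T₂ x))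
        (pairWalkSets (W₁ x) (W₂ x) (locDataY x (E₁ x) (X₁ x) (M₁ x) (diam x)).Touches
          (locData₂ (locDataY x (E₁ x) (X₁ x) (M₁ x) (diam x)) (X₂ x) (M₂ x)).Touches) U) :
    B9.Thm314Printed c35Y geo9Y (bg9Y (Matrix (Fin N) (Fin N) ℂ) (specialUnitaryUnits (Fin N)))
        (fun x => ((opsYOfRecordDE N θ Mstar 𝔯 𝔈) x).Kdiff) dOmegaY ∧
      B9Thm314.Thm314LocalPrinted c35Y geo9Y (bg9Y (Matrix (Fin N) (Fin N) ℂ) (specialUnitaryUnits (Fin N)))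
        (fun x => ((opsYOfRecordDE N θ Mstar 𝔯 𝔈) x).Kdiff) OmKY dOmegaY :=
  thm314_pair_layerOfLetters (lettersYOfRecordDE N θ Mstar 𝔯) 𝔈 T₁ T₂ (fun x => locDataY x (E₁ x) (X₁ x) (M₁ x) (diam x)) X₂ M₂
    (fun x => locDataY_laws x (E₁ x) (near₁ x) (first₁ x) (chain₁ x))
    (fun x => locDataY_laws x (E₂ x) (near₂ x) (first₂ x) (chain₂ x)) r₀ hr
    (fun x => modelSignsOn_geo9K x.toKIdx) (fun x y y' => dOmegaY_nonneg x y y') h₁ h₂ W₁ W₂ hW₁ hW₂ hcnt₁ hcnt₂ hexp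

end Literature.MathematicalPhysics.QuantumFieldTheory.Balaban1983to89.B9Thm314Thm315RecordDE

end
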